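import Mathlib.Tactic.DeriveFintype
import Literature.Computability.Complexity.StackStrings
import Literature.Computability.Complexity.TM2PassThrough
import HarnessLib

/-!
# Bricks: packaging verified stack routines as `FP` string functions on pair-coded arguments

Trunk `CplxCore`, toolkit continuing `StackPrograms.lean` (`Com`, `Com.mem_FP`),
`StackArith.lean` (the bank `AReg` with `add`/`sub`/`normalize`) and `StackStrings.lean`
(`unpairW`, the pair decoder). The tree assembles larger polynomial-time functions in two styles:
one structured program (`ShorOrdPost.lean`, `TautMachine.lean`), or an **algebra of `FP` string
functions** (`comp_mem_FP`, `fanoutFn`, `iteFn`, `iterate_mem_FP`, projections `boolUnpair`).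
For the second style every arithmetic routine must be available as a *total* `FP` function on
`boolPair`-coded operands; this file provides the generic packaging and the first instances.

* `Brick.unOpProg c ix ox` / **`Brick.unOp_mem_FP`**: a routine `c : Com ρ` (any register type)
  that, started with operand `a` in register `ix` and everything else empty, runs within
  `C |a|` steps and leaves `res a` in `ox`, yields the `FP` function `res` (input moved to `ix`,
  routine framed by `Com.map Sum.inr`, result poured to the output register), provided `C` and
  `|res a|` are dominated by a polynomial.
* `Brick.binOpProg c ix iy ox` / **`Brick.binOp_mem_FP`**: the same for two operands presented as
  `boolPair a b` (decoded by `unpairW`): the `FP` function `w ↦ res (boolUnpair w).1 (boolUnpair w).2`.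
* Instances on numerals (`bitsToNat`, least significant bit first; results canonical,
  `encodeNat`): `norm_mem_FP` (`norm` itself), `addFn` (sum), `subFn` (truncated difference), `ltFn`
  (the comparison bit `[decide (a < b)]`), and the one-bit tests `isNilFn`, `parityFn`
  (`[decide (Even a)]`), `lenLeOneFn` (`[decide (|w| ≤ 1)]`), `valGeTwoFn` (`[decide (2 ≤ a)]`) —
  one-bit outputs being the format of conditions of `iteFn` (`BranchingFn.lean`).

## References

* S. Arora, B. Barak, *Computational Complexity: A Modern Approach*, CUP 2009, §1.3 (polynomial
  time is closed under composition; subroutines), §0.1 (pairing).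
* T. Nipkow, G. Klein, *Concrete Semantics with Isabelle/HOL*, Springer 2014, Ch. 7 (big-step
  framing of sub-programs).
-/

namespace Literature.Computability.Complexity

open _root_.Computability AReg

/-- `2 |fst| + |snd| ≤ |w|` for the pair decoder (private copy of
`CookReducibilityTransitive.length_boolUnpair_le`, whose import closure is not wanted here).
[folklore] -/
private theorem length_boolUnpair_le' : ∀ w : List Bool,
    2 * (boolUnpair w).1.length + (boolUnpair w).2.length ≤ w.length
  | [] => by simp [boolUnpair]
  | [b] => by simp [boolUnpair]
  | b :: b' :: rest => by
    have ih := length_boolUnpair_le' rest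
    by_cases h : b = b'
    · subst h
      simp only [boolUnpair, if_true, List.length_cons]
      omega
    · cases b'
      · simp [boolUnpair, h]
      · simp [boolUnpair, h]; omega

namespace Brick

/-- The wrapper's own registers: input, output, and the scratch of the pair decoder.
[folklore] -/
inductive W
  | inp | out | A | T | M | P | S
  deriving DecidableEq, Fintype, Repr

variable {ρ : Type} [DecidableEq ρ] [Fintype ρ]

omit [Fintype ρ] in
/-- The register file of a routine started on one operand. [folklore] -/
def init1 (ix : ρ) (a : List Bool) : Regs ρ := Function.update (fun _ => []) ix a

/-- The register file of a routine started on two operands. [folklore] -/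
def init2 (ix iy : ρ) (a b : List Bool) : Regs ρ :=
  Function.update (Function.update (fun _ => []) ix a) iy b

/-! ### One operand -/

/-- `unOpProg c ix ox`: move the input into the routine's register `ix`, run the routine
(framed on the right of `W ⊕ ρ`), pour its result register `ox` to the output (two pours keep
the order). [cite: AroraBarak2009, §1.3 (subroutines)] -/
def unOpProg (c : Com ρ) (ix ox : ρ) : Com (W ⊕ ρ) :=
  Com.move (Sum.inl .inp) (Sum.inr ix) (Sum.inl .A) ;;
  (c.map Sum.inr ;;
  (Com.pour (Sum.inr ox) (Sum.inl .S) ;; Com.pour (Sum.inl .S) (Sum.inl .out)))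

/-- **A routine on one operand, packaged as an `FP` function.** If from `init1 ix a` the routine
runs within `C |a|` steps leaving `res a` in `ox`, with `C` and `|res a|` dominated by the
polynomial `p`, then `res ∈ FP`. [cite: AroraBarak2009, §1.3 (polynomial time is closed under subroutine calls)] -/
theorem unOp_mem_FP (c : Com ρ) (ix ox : ρ) (res : List Bool → List Bool) (C : ℕ → ℕ)
    (p : Polynomial ℕ) (hC : ∀ n, C n ≤ p.eval n) (hres : ∀ a, (res a).length ≤ p.eval a.length)
    (hc : ∀ a, ∃ R', Com.Runs c (init1 ix a) R' (C a.length) ∧ R' ox = res a) :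
    res ∈ FP := by
  refine Com.mem_FP (unOpProg c ix ox) (Sum.inl W.inp) (Sum.inl W.out)
    (12 * Polynomial.X + 8 + 7 * p) res fun z => ?_
  obtain ⟨R', hrun, hout⟩ := hc z
  -- stage 1: move the input
  set R0 : Regs (W ⊕ ρ) := Regs.init (Sum.inl W.inp) z with hR0
  have hR0' : R0 = Sum.elim (Function.update (fun _ => []) W.inp z) (fun _ => []) := by
    funext i; rcases i with i | i
    · by_cases hi : i = W.inp
      · subst hi; simp [hR0, Regs.init]
      · simp [hR0, Regs.init, hi]
    · simp [hR0, Regs.init]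
  have h1 := Com.runs_move (a := (Sum.inl W.inp : W ⊕ ρ)) (b := Sum.inr ix) (t := Sum.inl W.A)
    (by simp) (by simp) (by simp) R0 (by rw [hR0']; simp)
  have hR1 : Function.update (Function.update R0 (Sum.inl W.inp) []) (Sum.inr ix) (R0 (Sum.inl W.inp) ++ R0 (Sum.inr ix)) =
      Sum.elim (fun _ => []) (init1 ix z) := by
    rw [hR0']
    funext i; rcases i with i | i
    · by_cases hi : i = W.inp
      · subst hi; simp
      · simp
    · by_cases hi : i = ix
      · subst hi; simp [init1]
      · simp [hi, init1]
  rw [hR1] at h1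
  have hz : R0 (Sum.inl W.inp) = z := by rw [hR0']; simp
  rw [hz] at h1
  -- stage 2: the routine
  have h2 : Com.Runs (c.map Sum.inr : Com (W ⊕ ρ)) (Sum.elim (fun _ => []) (init1 ix z)) (Sum.elim (fun _ => []) R') (C z.length) :=
    hrun.inr _
  -- stage 3: output
  have h3 := Com.runs_pour (a := (Sum.inr ox : W ⊕ ρ)) (b := Sum.inl W.S) (by simp) (Sum.elim (fun _ : W => ([] : List Bool)) R')
  rw [Sum.elim_inr, Sum.elim_inl, List.append_nil] at h3
  set R3 : Regs (W ⊕ ρ) := Function.update (Function.update (Sum.elim (fun _ : W => ([] : List Bool)) R') (Sum.inr ox) []) (Sum.inl W.S) (R' ox).reverse with hR3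
  have h4 := Com.runs_pour (a := (Sum.inl W.S : W ⊕ ρ)) (b := Sum.inl W.out) (by simp) R3
  have hR3S : R3 (Sum.inl W.S) = (R' ox).reverse := by rw [hR3, Function.update_self]
  have hR3out : R3 (Sum.inl W.out) = [] := by
    rw [hR3, Function.update_of_ne (by simp), Function.update_of_ne (by simp)]; rfl
  rw [hR3S, hR3out, List.reverse_reverse, List.append_nil] at h4
  refine ⟨_, Or.inl ((h1.seq (h2.seq (h3.seq h4))).mono ?_), by simp [hout]⟩
  -- the budget
  have hp := hC z.length
  have hl := hres z
  rw [← hout] at hl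
  simp only [Polynomial.eval_add, Polynomial.eval_mul, Polynomial.eval_ofNat, Polynomial.eval_X, List.length_reverse]
  omega

/-! ### Two operands -/

/-- `binOpProg c ix iy ox`: decode the input pair `⟨a, b⟩` (`unpairW`, parts reversed on `A`,
`T`), pour `a` into `ix` and `b` into `iy` (restoring the order), run the routine, pour its
result register `ox` to the output. [cite: AroraBarak2009, §1.3 (subroutines)] -/
def binOpProg (c : Com ρ) (ix iy ox : ρ) : Com (W ⊕ ρ) :=
  Com.unpairW (Sum.inl .inp) (Sum.inl .A) (Sum.inl .T) (Sum.inl .M) (Sum.inl .P) ;;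
  (Com.pour (Sum.inl .A) (Sum.inr ix) ;;
  (Com.pour (Sum.inl .T) (Sum.inr iy) ;;
  (Com.clear (Sum.inl .M) ;;
  (c.map Sum.inr ;;
  (Com.pour (Sum.inr ox) (Sum.inl .S) ;; Com.pour (Sum.inl .S) (Sum.inl .out))))))

/-- **A routine on two operands, packaged as an `FP` function on pairs.** If from
`init2 ix iy a b` (`ix ≠ iy`) the routine runs within `C (|a| + |b|)` steps leaving `res a b` in
`ox`, with `C` and `|res a b|` dominated by the polynomial `p`, then
`w ↦ res (boolUnpair w).1 (boolUnpair w).2 ∈ FP`. [cite: AroraBarak2009, §1.3 (polynomial time is closed under subroutine calls)] -/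
theorem binOp_mem_FP (c : Com ρ) {ix iy : ρ} (hxy : ix ≠ iy) (ox : ρ) (res : List Bool → List Bool → List Bool)
    (C : ℕ → ℕ) (p : Polynomial ℕ) (hC : ∀ n, C n ≤ p.eval n)
    (hres : ∀ a b, (res a b).length ≤ p.eval (a.length + b.length))
    (hc : ∀ a b, ∃ R', Com.Runs c (init2 ix iy a b) R' (C (a.length + b.length)) ∧ R' ox = res a b) :
    (fun w => res (boolUnpair w).1 (boolUnpair w).2) ∈ FP := by
  refine Com.mem_FP (binOpProg c ix iy ox) (Sum.inl W.inp) (Sum.inl W.out)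
    (16 * Polynomial.X + 16 + 7 * p) _ fun z => ?_
  set a := (boolUnpair z).1 with ha
  set b := (boolUnpair z).2 with hb
  obtain ⟨R', hrun, hout⟩ := hc a b
  set R0 : Regs (W ⊕ ρ) := Regs.init (Sum.inl W.inp) z with hR0
  have hR0' : R0 = Sum.elim (Function.update (fun _ => []) W.inp z) (fun _ => []) := by
    funext i; rcases i with i | i
    · by_cases hi : i = W.inp
      · subst hi; simp [hR0, Regs.init]
      · simp [hR0, Regs.init, hi]
    · simp [hR0, Regs.init]
  -- stage 1: unpairW
  have hd : [(Sum.inl W.inp : W ⊕ ρ), Sum.inl W.A, Sum.inl W.T, Sum.inl W.M, Sum.inl W.P].Nodup := by simp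
  have h1 := Com.runs_unpairW hd R0 (by rw [hR0']; simp) (by rw [hR0']; simp)
  have hz : R0 (Sum.inl W.inp) = z := by rw [hR0']; simp
  rw [hz] at h1
  set R1 : Regs (W ⊕ ρ) := Function.update (Function.update (Function.update (Function.update (Function.update R0
    (Sum.inl W.inp) []) (Sum.inl W.A) ((boolUnpair z).1.reverse ++ R0 (Sum.inl W.A))) (Sum.inl W.T)
    ((boolUnpair z).2.reverse ++ R0 (Sum.inl W.T))) (Sum.inl W.M) (flag (wellPaired z))) (Sum.inl W.P) [] with hR1
  have hR1' : R1 = Sum.elim (Function.update (Function.update (Function.update (fun _ => []) W.A a.reverse) W.T b.reverse)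
      W.M (flag (wellPaired z))) (fun _ => []) := by
    rw [hR1, hR0']
    funext i; rcases i with i | i
    · cases i <;> simp [ha, hb]
    · simp
  -- stage 2: pour A into ix
  have h2 := Com.runs_pour (a := (Sum.inl W.A : W ⊕ ρ)) (b := Sum.inr ix) (by simp) R1
  have hR1A : R1 (Sum.inl W.A) = a.reverse := by rw [hR1']; simp
  have hR1x : R1 (Sum.inr ix) = [] := by rw [hR1']; simp
  rw [hR1A, hR1x, List.reverse_reverse, List.append_nil] at h2
  set R2 : Regs (W ⊕ ρ) := Function.update (Function.update R1 (Sum.inl W.A) []) (Sum.inr ix) a with hR2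
  -- stage 3: pour T into iy
  have h3 := Com.runs_pour (a := (Sum.inl W.T : W ⊕ ρ)) (b := Sum.inr iy) (by simp) R2
  have hR2T : R2 (Sum.inl W.T) = b.reverse := by rw [hR2, hR1']; simp
  have hR2y : R2 (Sum.inr iy) = [] := by
    rw [hR2, Function.update_of_ne (by simpa using hxy.symm), hR1']; simp
  rw [hR2T, hR2y, List.reverse_reverse, List.append_nil] at h3
  set R3 : Regs (W ⊕ ρ) := Function.update (Function.update R2 (Sum.inl W.T) []) (Sum.inr iy) b with hR3
  -- stage 4: clear M
  have h4 := Com.runs_clear (Sum.inl W.M : W ⊕ ρ) R3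
  have hR3M : R3 (Sum.inl W.M) = flag (wellPaired z) := by rw [hR3, hR2, hR1']; simp
  have hR4 : Function.update R3 (Sum.inl W.M) [] = Sum.elim (fun _ => []) (init2 ix iy a b) := by
    rw [hR3, hR2, hR1']
    funext i; rcases i with i | i
    · cases i <;> simp
    · by_cases hiy : i = iy
      · subst hiy; simp [init2]
      · by_cases hix : i = ix
        · subst hix; simp [init2, hiy]
        · simp [init2, hiy, hix]
  rw [hR4, hR3M] at h4
  -- stage 5: the routine
  have h5 : Com.Runs (c.map Sum.inr : Com (W ⊕ ρ)) (Sum.elim (fun _ => []) (init2 ix iy a b)) (Sum.elim (fun _ => []) R')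
      (C (a.length + b.length)) := hrun.inr _
  -- stage 6: output
  have h6 := Com.runs_pour (a := (Sum.inr ox : W ⊕ ρ)) (b := Sum.inl W.S) (by simp) (Sum.elim (fun _ : W => ([] : List Bool)) R')
  rw [Sum.elim_inr, Sum.elim_inl, List.append_nil] at h6
  set R6 : Regs (W ⊕ ρ) := Function.update (Function.update (Sum.elim (fun _ : W => ([] : List Bool)) R') (Sum.inr ox) []) (Sum.inl W.S) (R' ox).reverse with hR6
  have h7 := Com.runs_pour (a := (Sum.inl W.S : W ⊕ ρ)) (b := Sum.inl W.out) (by simp) R6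
  have hR6S : R6 (Sum.inl W.S) = (R' ox).reverse := by rw [hR6, Function.update_self]
  have hR6out : R6 (Sum.inl W.out) = [] := by
    rw [hR6, Function.update_of_ne (by simp), Function.update_of_ne (by simp)]; rfl
  rw [hR6S, hR6out, List.reverse_reverse, List.append_nil] at h7
  refine ⟨_, Or.inl ((h1.seq (h2.seq (h3.seq (h4.seq (h5.seq (h6.seq h7)))))).mono ?_), by simp [hout]⟩
  -- the budget: |a| + |b| ≤ |z|
  have hab : a.length + b.length ≤ z.length := by
    have := length_boolUnpair_le' z; rw [← ha, ← hb] at this; omega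
  have hp := (hC (a.length + b.length)).trans (TM2Iter.eval_mono p hab)
  have hl := (hres a b).trans (TM2Iter.eval_mono p hab)
  rw [← hout] at hl
  have hfl := Com.length_flag_le (wellPaired z)
  simp only [Polynomial.eval_add, Polynomial.eval_mul, Polynomial.eval_ofNat, Polynomial.eval_X, List.length_reverse]
  omega


/-! ### Bank routines as bricks -/

/-- The two-operand start file on the arithmetic bank is `file a b [] … []`. [folklore] -/
theorem init2_bank (a b : List Bool) : init2 AReg.x AReg.y a b = file a b [] [] [] [] [] [] := by
  funext i; cases i <;> rfl

/-- The one-operand start file on the arithmetic bank is `file a [] … []`. [folklore] -/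
theorem init1_bank (a : List Bool) : init1 AReg.x a = file a [] [] [] [] [] [] [] := by
  funext i; cases i <;> rfl

/-- A canonical numeral is no longer than any numeral of the same value: `|encodeNat ⟦w⟧| ≤ |w|`.
[folklore] -/
theorem length_encodeNat_bitsToNat_le (w : List Bool) : (encodeNat (bitsToNat w)).length ≤ w.length := by
  rw [← norm_eq_encodeNat]; exact length_norm_le w

/-! #### Normalisation -/

/-- **`norm ∈ FP`** (strip the redundant high zeros of a numeral). [folklore] -/
theorem norm_mem_FP : (norm : List Bool → List Bool) ∈ FP := by
  refine unOp_mem_FP Com.normalize AReg.x AReg.x norm (fun n => 9 * n + 5) (9 * Polynomial.X + 5)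
    (fun n => by simp) (fun a => ?_) (fun a => ?_)
  · have := length_norm_le a; simp; omega
  · rw [init1_bank]; exact ⟨_, Com.runs_normalize a [] [] [] [] [], rfl⟩

/-! #### Addition -/

/-- The sum brick's routine: `add`, then `normalize`. [folklore] -/
def addC : Com AReg := Com.add ;; Com.normalize

/-- `addFn ⟨a, b⟩ = encodeNat (⟦a⟧ + ⟦b⟧)` (total: on every string, via `boolUnpair`). [folklore] -/
def addFn (w : List Bool) : List Bool :=
  encodeNat (bitsToNat (boolUnpair w).1 + bitsToNat (boolUnpair w).2)

/-- `addFn` on a pair. [folklore] -/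
@[simp] theorem addFn_boolPair (a b : List Bool) : addFn (boolPair a b) = encodeNat (bitsToNat a + bitsToNat b) := by
  simp [addFn]

/-- **`addFn ∈ FP`.** [cite: AroraBarak2009, §1.3 (polynomial time is closed under subroutine calls)] -/
theorem addFn_mem_FP : addFn ∈ FP := by
  refine binOp_mem_FP addC (show AReg.x ≠ AReg.y by decide) AReg.x
    (fun a b => encodeNat (bitsToNat a + bitsToNat b)) (fun n => 22 * n + 26) (22 * Polynomial.X + 26)
    (fun n => by simp) (fun a b => ?_) (fun a b => ?_)
  · have h1 := length_encodeNat_bitsToNat_le (Com.addRes a b)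
    rw [Com.bitsToNat_addRes] at h1
    have h2 := Com.length_addRes_le a b
    simp; omega
  · rw [init2_bank]
    have h1 := Com.runs_add a b [] [] []
    have h2 := Com.runs_normalize (Com.addRes a b) b [] [] [] []
    have hl := Com.length_addRes_le a b
    exact ⟨_, (h1.seq h2).of_eq rfl (by omega), by simp [norm_eq_encodeNat, Com.bitsToNat_addRes]⟩

/-! #### Truncated subtraction and comparison -/

/-- The difference brick's routine: `sub`; if no borrow occurred, `normalize`, else clear `x`
(truncation at `0`); the borrow flag (`g`) is consumed. [folklore] -/
def subC : Com AReg :=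
  Com.sub ;; (Com.pop .g Com.normalize (Com.clear .x) (Com.clear .x))

/-- `subFn ⟨a, b⟩ = encodeNat (⟦a⟧ - ⟦b⟧)` (truncated subtraction). [folklore] -/
def subFn (w : List Bool) : List Bool :=
  encodeNat (bitsToNat (boolUnpair w).1 - bitsToNat (boolUnpair w).2)

/-- `subFn` on a pair. [folklore] -/
@[simp] theorem subFn_boolPair (a b : List Bool) : subFn (boolPair a b) = encodeNat (bitsToNat a - bitsToNat b) := by
  simp [subFn]

/-- Sizes are monotone: `|encodeNat m| ≤ |encodeNat n|` for `m ≤ n`. [folklore] -/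
theorem length_encodeNat_mono {m n : ℕ} (h : m ≤ n) : (encodeNat m).length ≤ (encodeNat n).length := by
  rw [TM2Pass.length_encodeNat_eq_size, TM2Pass.length_encodeNat_eq_size]; exact Nat.size_le_size h

/-- **`subFn ∈ FP`.** [cite: AroraBarak2009, §1.3 (polynomial time is closed under subroutine calls)] -/
theorem subFn_mem_FP : subFn ∈ FP := by
  refine binOp_mem_FP subC (show AReg.x ≠ AReg.y by decide) AReg.x
    (fun a b => encodeNat (bitsToNat a - bitsToNat b)) (fun n => 25 * n + 20) (25 * Polynomial.X + 20)
    (fun n => by simp) (fun a b => ?_) (fun a b => ?_)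
  · have h1 := length_encodeNat_bitsToNat_le a
    have h2 := length_encodeNat_mono (Nat.sub_le (bitsToNat a) (bitsToNat b))
    simp; omega
  · rw [init2_bank]
    have h1 := Com.runs_sub a b []
    cases hb : Com.subBorrow a b
    · -- no borrow: `⟦b⟧ ≤ ⟦a⟧`, normalise the difference
      rw [hb] at h1
      simp only [cond_false, Bool.not_false, flag_true] at h1
      have hle : bitsToNat b ≤ bitsToNat a := by simpa [Com.subBorrow_iff] using hb
      have h := Com.runs_normalize (Com.subRes a b) b [] [] [] []
      rw [Com.length_subRes] at h
      have h2 : Com.Runs (Com.pop .g Com.normalize (Com.clear .x) (Com.clear .x))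
          (file (Com.subRes a b) b [] [] [] [] [] [true]) (file (norm (Com.subRes a b)) b [] [] [] [] [] []) (9 * a.length + 5 + 2) :=
        Com.Runs.pop_true (k := AReg.g) (R := file (Com.subRes a b) b [] [] [] [] [] [true]) _ _ (w := []) rfl (by simpa using h)
      refine ⟨_, (h1.seq h2).of_eq rfl ?_, ?_⟩
      · omega
      · simp [norm_eq_encodeNat, Com.bitsToNat_subRes a b hle]
    · -- borrow: `⟦a⟧ < ⟦b⟧`, the difference is `0`
      rw [hb] at h1
      simp only [cond_true, Bool.not_true, flag_false] at h1
      have hlt : bitsToNat a < bitsToNat b := by simpa [Com.subBorrow_iff] using hb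
      have h2 : Com.Runs (Com.pop .g Com.normalize (Com.clear .x) (Com.clear .x))
          (file a b [] [] [] [] [] []) (file [] b [] [] [] [] [] []) (2 * a.length + 3) :=
        (Com.Runs.pop_nil _ _ rfl (Com.runs_clear AReg.x _)).of_eq (by simp) (by simp)
      refine ⟨_, (h1.seq h2).of_eq rfl ?_, ?_⟩
      · omega
      · simp [Nat.sub_eq_zero_of_le hlt.le]; rfl

/-- The comparison brick's routine: `sub`, clear `x`, then turn the (negated) borrow flag into
one bit on `x`. [folklore] -/
def ltC : Com AReg :=
  Com.sub ;; (Com.clear .x ;; Com.pop .g (Com.push .x false) (Com.push .x true) (Com.push .x true))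

/-- `ltFn ⟨a, b⟩ = [decide (⟦a⟧ < ⟦b⟧)]` — a one-bit condition for `iteFn`. [folklore] -/
def ltFn (w : List Bool) : List Bool :=
  [decide (bitsToNat (boolUnpair w).1 < bitsToNat (boolUnpair w).2)]

/-- `ltFn` on a pair. [folklore] -/
@[simp] theorem ltFn_boolPair (a b : List Bool) : ltFn (boolPair a b) = [decide (bitsToNat a < bitsToNat b)] := by
  simp [ltFn]

/-- **`ltFn ∈ FP`.** [cite: AroraBarak2009, §1.3 (polynomial time is closed under subroutine calls)] -/
theorem ltFn_mem_FP : ltFn ∈ FP := by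
  refine binOp_mem_FP ltC (show AReg.x ≠ AReg.y by decide) AReg.x
    (fun a b => [decide (bitsToNat a < bitsToNat b)]) (fun n => 18 * n + 16) (18 * Polynomial.X + 16)
    (fun n => by simp) (fun a b => by simp) (fun a b => ?_)
  rw [init2_bank]
  have h1 := Com.runs_sub a b []
  set x1 := (bif Com.subBorrow a b then a else Com.subRes a b) with hx1
  have hx1l : x1.length = a.length := by rw [hx1]; cases Com.subBorrow a b <;> simp [Com.length_subRes]
  have h2 : Com.Runs (Com.clear .x) (file x1 b [] [] [] [] [] (flag !Com.subBorrow a b))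
      (file [] b [] [] [] [] [] (flag !Com.subBorrow a b)) (2 * a.length + 1) :=
    (Com.runs_clear AReg.x _).of_eq (by simp) (by simp [hx1l])
  have h3 : Com.Runs (Com.pop .g (Com.push .x false) (Com.push .x true) (Com.push .x true))
      (file [] b [] [] [] [] [] (flag !Com.subBorrow a b)) (file [decide (bitsToNat a < bitsToNat b)] b [] [] [] [] [] []) 3 := by
    rw [Com.subBorrow_iff]
    by_cases hlt : bitsToNat a < bitsToNat b
    · simp only [hlt, decide_true, Bool.not_true, flag_false]
      exact (Com.Runs.pop_nil _ _ rfl (Com.Runs.push' (by simp))).of_eq rfl (by omega)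
    · simp only [hlt, decide_false, Bool.not_false, flag_true]
      have h : Com.Runs (Com.push .x false) (file [] b [] [] [] [] [] []) (file [false] b [] [] [] [] [] []) 1 :=
        Com.Runs.push' (by simp)
      exact (Com.Runs.pop_true (k := AReg.g) (R := file [] b [] [] [] [] [] [true]) _ _ (w := []) rfl (by simpa using h)).of_eq rfl
        (by omega)
  refine ⟨_, (h1.seq (h2.seq h3)).of_eq rfl ?_, rfl⟩
  omega

/-! #### One-bit tests -/

/-- The emptiness test's routine: one `pop` (restoring), answer on `y`. [folklore] -/
def isNilC : Com AReg :=
  Com.pop .x (Com.push .x true ;; Com.push .y false) (Com.push .x false ;; Com.push .y false) (Com.push .y true)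

/-- `isNilFn w = [decide (w = [])]`. [folklore] -/
def isNilFn (w : List Bool) : List Bool := [decide (w = [])]

/-- **`isNilFn ∈ FP`.** [folklore] -/
theorem isNilFn_mem_FP : isNilFn ∈ FP := by
  refine unOp_mem_FP isNilC AReg.x AReg.y isNilFn (fun _ => 4) 4 (fun n => by simp) (fun a => by simp [isNilFn])
    (fun a => ?_)
  rw [init1_bank]
  rcases a with _ | ⟨b, a⟩
  · have h : Com.Runs (Com.push .y true) (file [] [] [] [] [] [] [] []) (file [] [true] [] [] [] [] [] []) 1 :=
      Com.Runs.push' (by simp)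
    exact ⟨_, (Com.Runs.pop_nil _ _ rfl h).of_eq rfl (by omega), rfl⟩
  · have h : ∀ c : Bool, Com.Runs (Com.push .x c ;; Com.push .y false) (file a [] [] [] [] [] [] [])
        (file (c :: a) [false] [] [] [] [] [] []) 2 := fun c =>
      (Com.Runs.push' rfl).seq (Com.Runs.push' (by simp))
    cases b
    · exact ⟨_, (Com.Runs.pop_false' _ _ (R₀ := file a [] [] [] [] [] [] []) rfl (by simp) (h false)).of_eq rfl
        (by omega), rfl⟩
    · exact ⟨_, (Com.Runs.pop_true' _ _ (R₀ := file a [] [] [] [] [] [] []) rfl (by simp) (h true)).of_eq rfl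
        (by omega), rfl⟩

/-- The parity test's routine: one `pop` (restoring), answer on `y` — a numeral (least
significant bit first) is even iff it is empty or starts with `0`. [folklore] -/
def parityC : Com AReg :=
  Com.pop .x (Com.push .x true ;; Com.push .y false) (Com.push .x false ;; Com.push .y true) (Com.push .y true)

/-- `parityFn w = [decide (Even ⟦w⟧)]`. [folklore] -/
def parityFn (w : List Bool) : List Bool := [decide (Even (bitsToNat w))]

/-- Parity of a numeral read off its first bit. [folklore] -/
theorem even_bitsToNat_cons (b : Bool) (w : List Bool) : Even (bitsToNat (b :: w)) ↔ b = false := by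
  rw [bitsToNat_cons]
  cases b <;> simp [Nat.even_add]

/-- **`parityFn ∈ FP`.** [folklore] -/
theorem parityFn_mem_FP : parityFn ∈ FP := by
  refine unOp_mem_FP parityC AReg.x AReg.y parityFn (fun _ => 4) 4 (fun n => by simp) (fun a => by simp [parityFn])
    (fun a => ?_)
  rw [init1_bank]
  rcases a with _ | ⟨b, a⟩
  · have h : Com.Runs (Com.push .y true) (file [] [] [] [] [] [] [] []) (file [] [true] [] [] [] [] [] []) 1 :=
      Com.Runs.push' (by simp)
    exact ⟨_, (Com.Runs.pop_nil _ _ rfl h).of_eq rfl (by omega), by simp [parityFn]⟩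
  · have h : ∀ c d : Bool, Com.Runs (Com.push .x c ;; Com.push .y d) (file a [] [] [] [] [] [] [])
        (file (c :: a) [d] [] [] [] [] [] []) 2 := fun c d =>
      (Com.Runs.push' rfl).seq (Com.Runs.push' (by simp))
    cases b
    · exact ⟨_, (Com.Runs.pop_false' _ _ (R₀ := file a [] [] [] [] [] [] []) rfl (by simp) (h false true)).of_eq rfl
        (by omega), by simp [parityFn]⟩
    · exact ⟨_, (Com.Runs.pop_true' _ _ (R₀ := file a [] [] [] [] [] [] []) rfl (by simp) (h true false)).of_eq rfl
        (by omega), by simp [parityFn]⟩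

/-- Pop up to two symbols of `x` (consumed) and answer on `y` whether there were two:
the common routine of the two length tests below. [folklore] -/
def twoSymC (yes no : Bool) : Com AReg :=
  Com.pop .x (Com.pop .x (Com.push .y yes) (Com.push .y yes) (Com.push .y no))
    (Com.pop .x (Com.push .y yes) (Com.push .y yes) (Com.push .y no)) (Com.push .y no)

/-- **Effect of `twoSymC`**: `y := [if 2 ≤ |x| then yes else no]`, `x` loses its first two
symbols, in at most `5` steps. [folklore] -/
theorem runs_twoSymC (yes no : Bool) (v : List Bool) :
    Com.Runs (twoSymC yes no) (file v [] [] [] [] [] [] [])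
      (file (v.drop 2) [if 2 ≤ v.length then yes else no] [] [] [] [] [] []) 5 := by
  rcases v with _ | ⟨b, _ | ⟨b', v⟩⟩
  · exact (Com.Runs.pop_nil _ _ rfl (Com.Runs.push' rfl)).of_eq (by simp) (by omega)
  · have h : Com.Runs (Com.pop .x (Com.push .y yes) (Com.push .y yes) (Com.push .y no))
        (file [] [] [] [] [] [] [] []) (file [] [no] [] [] [] [] [] []) 3 :=
      (Com.Runs.pop_nil _ _ rfl (Com.Runs.push' rfl)).of_eq (by simp) (by omega)
    cases b
    · exact (Com.Runs.pop_false' _ _ (R₀ := file [] [] [] [] [] [] [] []) rfl (by simp) h).of_eq (by simp) (by omega)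
    · exact (Com.Runs.pop_true' _ _ (R₀ := file [] [] [] [] [] [] [] []) rfl (by simp) h).of_eq (by simp) (by omega)
  · have h : ∀ c : Bool, Com.Runs (Com.pop .x (Com.push .y yes) (Com.push .y yes) (Com.push .y no))
        (file (c :: v) [] [] [] [] [] [] []) (file v [yes] [] [] [] [] [] []) 3 := by
      intro c; cases c
      · exact (Com.Runs.pop_false' _ _ (R₀ := file v [] [] [] [] [] [] []) rfl (by simp) (Com.Runs.push' (by simp))).of_eq
          rfl (by omega)
      · exact (Com.Runs.pop_true' _ _ (R₀ := file v [] [] [] [] [] [] []) rfl (by simp) (Com.Runs.push' (by simp))).of_eq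
          rfl (by omega)
    have e : file ((b :: b' :: v).drop 2) [if 2 ≤ (b :: b' :: v).length then yes else no] [] [] [] [] [] [] =
        file v [yes] [] [] [] [] [] [] := by simp
    rw [e]
    cases b
    · exact (Com.Runs.pop_false' _ _ (R₀ := file (b' :: v) [] [] [] [] [] [] []) rfl (by simp) (h b')).of_eq rfl (by omega)
    · exact (Com.Runs.pop_true' _ _ (R₀ := file (b' :: v) [] [] [] [] [] [] []) rfl (by simp) (h b')).of_eq rfl (by omega)

/-- `lenLeOneFn w = [decide (|w| ≤ 1)]` (for unary counters: "at most one unit left").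
[folklore] -/
def lenLeOneFn (w : List Bool) : List Bool := [decide (w.length ≤ 1)]

/-- **`lenLeOneFn ∈ FP`.** [folklore] -/
theorem lenLeOneFn_mem_FP : lenLeOneFn ∈ FP := by
  refine unOp_mem_FP (twoSymC false true) AReg.x AReg.y lenLeOneFn (fun _ => 5) 5 (fun n => by simp)
    (fun a => by simp [lenLeOneFn]) (fun a => ?_)
  rw [init1_bank]
  refine ⟨_, runs_twoSymC false true a, ?_⟩
  by_cases h : 2 ≤ a.length
  · simp [lenLeOneFn, h, show ¬ a.length ≤ 1 by omega]
  · simp [lenLeOneFn, h, show a.length ≤ 1 by omega]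

/-- `valGeTwoFn w = [decide (2 ≤ ⟦w⟧)]` (a canonical numeral has value `≥ 2` iff it has at least
two digits). [folklore] -/
def valGeTwoFn (w : List Bool) : List Bool := [decide (2 ≤ bitsToNat w)]

/-- `2 ≤ ⟦w⟧` iff the canonical numeral of `w` has at least two digits. [folklore] -/
theorem two_le_bitsToNat_iff (w : List Bool) : 2 ≤ bitsToNat w ↔ 2 ≤ (norm w).length := by
  rw [length_norm, show (2 ≤ (bitsToNat w).size ↔ 1 < (bitsToNat w).size) from Iff.rfl, Nat.lt_size, pow_one]

/-- **`valGeTwoFn ∈ FP`** (`normalize`, then the two-symbol test). [folklore] -/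
theorem valGeTwoFn_mem_FP : valGeTwoFn ∈ FP := by
  refine unOp_mem_FP (Com.normalize ;; twoSymC true false) AReg.x AReg.y valGeTwoFn (fun n => 9 * n + 10)
    (9 * Polynomial.X + 10) (fun n => by simp) (fun a => by simp [valGeTwoFn]) (fun a => ?_)
  rw [init1_bank]
  have hl := length_norm_le a
  refine ⟨_, ((Com.runs_normalize a [] [] [] [] []).seq (runs_twoSymC true false (norm a))).mono (by omega), ?_⟩
  by_cases h : 2 ≤ bitsToNat a
  · have h' := (two_le_bitsToNat_iff a).1 h
    simp [valGeTwoFn, h, h']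
  · have h' : ¬ 2 ≤ (norm a).length := fun h' => h ((two_le_bitsToNat_iff a).2 h')
    simp [valGeTwoFn, h, h']

end Brick

end Literature.Computability.Complexity
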